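import Summits.HodgeConjecture.HodgeConjecture.Theses.EndoscopicMiddleDegree
import Literature.AlgebraicGeometry.HodgeTheory.ComplexGysinCorrespondence
import Literature.AlgebraicGeometry.HodgeTheory.HodgeTypeConjugation

/-!
# Sketch — crux-ideate round 1, ideator 1, crux `OrthogonalEnveloped` (stmt-HodgeConjecture-14300)

First lemmas of the two idea cards filed by this seat (they ELABORATE; the first is also PROVED):

* `envelope_of_pureIdempotents` (card `purity-sorted-hecke-envelope`): the envelope `γ` of the crux
  is obtained from ANY finite family of algebraic classes `γ i` on `X × X` whose correspondence
  actions `ε i := corrP μ D (γ i)` preserve rational classes and are complete on `e`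
  (`∑ ε i e = e`), as soon as the `ε i` with Hodge-IMPURE image kill `e` — the sum of the PURE ones
  is the envelope. No theta lifts, no Arthur packets, no use of the hypothesis `e ⊥ TW(D)`.
* `nn_mem_ajTypes_iff` / the `N = 7` census (card `middle-involution-purity`): Vogan–Zuckerman
  bidegrees of Adams–Johnson packet members as pure combinatorics of block compositions of the
  `2n+1` infinitesimal-character slots; type `(n,n)` occurs exactly for the member whose
  non-compact block is central.

`corrP μ D γ` is the crux's inline operator `P β = pr₁₊(pr₂^* β ∪ γ)` written with the tree's
`corrAction` (`corrAction_apply` is `rfl`).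
-/

set_option linter.dupNamespace false

noncomputable section

open CategoryTheory MonoidalCategory CartesianMonoidalCategory
open Literature.AlgebraicGeometry Literature.AlgebraicGeometry.HodgeTheory
  Literature.AlgebraicGeometry.Motives Literature.AlgebraicGeometry.ShimuraVarieties
  Literature.AlgebraicTopology.SingularHomology
open Summit.HodgeConjecture.HodgeConjecture.Theses.EndoscopicMiddleDegree

namespace Summit.HodgeConjecture.HodgeConjecture.Cruxes.OrthogonalEnveloped.IdeatorOne

variable (μ : OrientationFamily) {m : ℕ} {X : SchemeOver ℂ}

/-- The crux's correspondence action `P β = pr₁₊(pr₂^* β ∪ γ)` (first factor receives), as the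
tree's `corrAction` in degrees `a = b = 2(m+1)`, `e = 2(m+1)`, `dim X = 2(m+1)`. -/
abbrev corrP (D : UnitaryBallQuotientDatum (2 * (m + 1)) X)
    (γ : complexBetti (X ⊗ X) (2 * (2 * (m + 1)))) :
    complexBetti X (2 * (m + 1)) →ₗ[ℂ] complexBetti X (2 * (m + 1)) :=
  corrAction μ D.isSmoothProjective D.isSmoothProjective
    (rfl : 2 * (m + 1) + 2 * (2 * (m + 1)) = 2 * (m + 1) + 2 * (2 * (m + 1))) γ

/-- `corrP` unfolds to the crux's literal term. -/
theorem corrP_apply (D : UnitaryBallQuotientDatum (2 * (m + 1)) X)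
    (γ : complexBetti (X ⊗ X) (2 * (2 * (m + 1)))) (β : complexBetti X (2 * (m + 1))) :
    corrP μ D γ β =
      complexGysin μ (IsSmoothProjective.tensor_holds D.isSmoothProjective D.isSmoothProjective)
        D.isSmoothProjective (fst X X)
        (show 2 * (m + 1) + 2 * (2 * (m + 1)) + 2 * (2 * (m + 1)) =
          2 * (m + 1) + 2 * (2 * (m + 1) + 2 * (m + 1)) by ring)
        (cupProduct (rfl : 2 * (m + 1) + 2 * (2 * (m + 1)) = 2 * (m + 1) + 2 * (2 * (m + 1)))
          (complexBetti.map (snd X X) (2 * (m + 1)) β) γ) :=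
  rfl

/-! ### Card 1 — `purity-sorted-hecke-envelope`: the envelope from pure idempotents -/

/-- A finite sum of rational classes is rational. -/
theorem isRationalClass_sum {Y : Type} [TopologicalSpace Y] {k : ℕ} {ι : Type} (s : Finset ι)
    (f : ι → singularCohomology ℂ ℂ Y k) (hf : ∀ i ∈ s, IsRationalClass (f i)) :
    IsRationalClass (∑ i ∈ s, f i) := by
  classical
  induction s using Finset.induction_on with
  | empty => simpa using IsRationalClass.zero
  | insert a s ha ih =>
    rw [Finset.sum_insert ha]
    exact (hf a (Finset.mem_insert_self a s)).add (ih fun i hi ↦ hf i (Finset.mem_insert_of_mem hi))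

/-- **First lemma of card `purity-sorted-hecke-envelope` (PROVED).** Let `ε i = corrP μ D (γ i)`
(`i ∈ s`) be the correspondence actions of finitely many ALGEBRAIC classes `γ i` on `X × X`
(intended: the primitive central idempotents of the image of the rational Hecke ring of level `Γ`,
each a `ℚ`-combination of Hecke double-coset graphs), preserving rational classes (`hrat`) and
complete on `e` (`hsum : ∑ ε i e = e`, i.e. `∑ ε i = 1`). If every `ε i` whose image contains a
class NOT of Hodge type `(n,n)` kills `e` (`hCV` — for Hecke pieces: the coefficient-conjugation
sieve on KILLED pieces, and the bet `CoreVanishing` on CORE pieces), then the sum of the `γ i` with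
Hodge-PURE action is an envelope of `e` in the sense of the crux: algebraic, rational-preserving,
purely `(n,n)` image, fixing `e`. The orthogonality hypothesis `e ⊥ TW(D)` of the crux is not used. -/
theorem envelope_of_pureIdempotents (D : UnitaryBallQuotientDatum (2 * (m + 1)) X)
    (e : complexBetti X (2 * (m + 1)))
    (he : IsOfHodgeType (2 * (m + 1)) X (2 * (m + 1)) (m + 1) (m + 1) e)
    {ι : Type} (s : Finset ι) (γ : ι → complexBetti (X ⊗ X) (2 * (2 * (m + 1))))
    (hγ : ∀ i ∈ s, γ i ∈ algebraicClasses (X ⊗ X) (2 * (m + 1)))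
    (hrat : ∀ i ∈ s, ∀ β, IsRationalClass β → IsRationalClass (corrP μ D (γ i) β))
    (hsum : ∑ i ∈ s, corrP μ D (γ i) e = e)
    (hCV : ∀ i ∈ s,
      (∃ β, ¬ IsOfHodgeType (2 * (m + 1)) X (2 * (m + 1)) (m + 1) (m + 1) (corrP μ D (γ i) β)) →
        corrP μ D (γ i) e = 0) :
    ∃ γ₀ ∈ algebraicClasses (X ⊗ X) (2 * (m + 1)),
      (∀ β, IsRationalClass β → IsRationalClass (corrP μ D γ₀ β)) ∧
      (∀ β, IsOfHodgeType (2 * (m + 1)) X (2 * (m + 1)) (m + 1) (m + 1) (corrP μ D γ₀ β)) ∧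
      corrP μ D γ₀ e = e := by
  classical
  obtain ⟨A, -⟩ := he
  -- the indices with Hodge-pure action
  set s' := s.filter fun i ↦
    ∀ β, IsOfHodgeType (2 * (m + 1)) X (2 * (m + 1)) (m + 1) (m + 1) (corrP μ D (γ i) β) with hs'
  have hs's : s' ⊆ s := Finset.filter_subset _ _
  have hlin : corrP μ D (∑ i ∈ s', γ i) = ∑ i ∈ s', corrP μ D (γ i) :=
    map_sum (corrAction μ D.isSmoothProjective D.isSmoothProjective _) _ _
  refine ⟨∑ i ∈ s', γ i, Submodule.sum_mem _ fun i hi ↦ hγ i (hs's hi), ?_, ?_, ?_⟩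
  · intro β hβ
    rw [hlin, LinearMap.sum_apply]
    exact isRationalClass_sum _ _ fun i hi ↦ hrat i (hs's hi) β hβ
  · intro β
    rw [hlin, LinearMap.sum_apply]
    refine IsOfHodgeType.sum D.isSmoothProjective A _ _ fun i hi ↦ ?_
    exact (Finset.mem_filter.mp hi).2 β
  · rw [hlin, LinearMap.sum_apply]
    have hsplit := Finset.sum_filter_add_sum_filter_not s
      (fun i ↦ ∀ β, IsOfHodgeType (2 * (m + 1)) X (2 * (m + 1)) (m + 1) (m + 1) (corrP μ D (γ i) β))
      (fun i ↦ corrP μ D (γ i) e)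
    have hzero : ∑ i ∈ s.filter (fun i ↦ ¬ ∀ β,
        IsOfHodgeType (2 * (m + 1)) X (2 * (m + 1)) (m + 1) (m + 1) (corrP μ D (γ i) β)),
        corrP μ D (γ i) e = 0 := by
      refine Finset.sum_eq_zero fun i hi ↦ ?_
      obtain ⟨hi, hne⟩ := Finset.mem_filter.mp hi
      exact hCV i hi (by push Not at hne; exact hne)
    rw [hzero, add_zero, hsum] at hsplit
    rw [hs']
    exact hsplit

/-- **Card 1's transfer `C⁺` (typed).** For every rational `(n,n)`-class `e` in the middle degree
of a compact `4`- or `6`-ball quotient: a finite family of algebraic classes on `X × X` (intended: the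
primitive central idempotents of the rational Hecke ring, realised by `ℚ`-combinations of Hecke
double-coset graphs) acting rationally, complete on `e`, whose Hodge-impure members kill `e`
(sieve + `CoreVanishing`). Strictly weaker data than the route's informal plan (no theta world, no
visibility, no Arthur packets) and it does not mention `TW(D)`. -/
def PureIdempotentData : Prop :=
  ∀ (μ : OrientationFamily), μ.HasPoincareDuality → ∀ (m : ℕ) (X : SchemeOver ℂ)
    (D : UnitaryBallQuotientDatum (2 * (m + 1)) X), 1 ≤ m → m ≤ 2 →
    ∀ e : complexBetti X (2 * (m + 1)), IsRationalClass e →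
      IsOfHodgeType (2 * (m + 1)) X (2 * (m + 1)) (m + 1) (m + 1) e →
      ∃ (ι : Type) (s : Finset ι) (γ : ι → complexBetti (X ⊗ X) (2 * (2 * (m + 1)))),
        (∀ i ∈ s, γ i ∈ algebraicClasses (X ⊗ X) (2 * (m + 1))) ∧
        (∀ i ∈ s, ∀ β, IsRationalClass β → IsRationalClass (corrP μ D (γ i) β)) ∧
        (∑ i ∈ s, corrP μ D (γ i) e = e) ∧
        (∀ i ∈ s, (∃ β, ¬ IsOfHodgeType (2 * (m + 1)) X (2 * (m + 1)) (m + 1) (m + 1)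
          (corrP μ D (γ i) β)) → corrP μ D (γ i) e = 0)

/-- **`C⁺ ⟹` the crux, BY NAME** (`_hperp`, the orthogonality to the theta world, is discarded). -/
theorem orthogonalEnveloped_of_pureIdempotentData (h : PureIdempotentData) :
    OrthogonalEnveloped := by
  intro μ hμ m X D h1 h2 e he_rat he_type _hperp
  obtain ⟨ι, s, γ, hγ, hrat, hsum, hCV⟩ := h μ hμ m X D h1 h2 e he_rat he_type
  obtain ⟨γ₀, hγ₀, h1', h2', h3'⟩ := envelope_of_pureIdempotents μ D e he_type s γ hγ hrat hsum hCV
  exact ⟨γ₀, hγ₀, h1', h2', h3'⟩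

/-! ### Card 2 — `middle-involution-purity`: Vogan–Zuckerman bidegrees of Adams–Johnson members -/

/-- For a composition `b : Fin r → ℕ` of the `2n+1` infinitesimal-character slots into consecutive
blocks (top to bottom) and the Adams–Johnson packet member whose NON-COMPACT factor `U(bᵢ−1,1)`
sits in block `i`: its `(𝔤,K)`-cohomology with trivial coefficients has Hodge bidegrees
`(R⁺ + j, R⁻ + j)`, `0 ≤ j < b i`, where `R⁺ = #slots above block i`, `R⁻ = #slots below`
(Vogan–Zuckerman: `R^± = dim 𝔲 ∩ 𝔭^±`, then the cohomology of the compact dual `ℙ^{bᵢ−1}` of the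
non-compact factor). -/
def ajTypes {r : ℕ} (b : Fin r → ℕ) (i : Fin r) : Finset (ℕ × ℕ) :=
  (Finset.range (b i)).image fun j ↦
    ((∑ k ∈ Finset.univ.filter (· < i), b k) + j, (∑ k ∈ Finset.univ.filter (i < ·), b k) + j)

/-- **First lemma of card `middle-involution-purity` (combinatorial shell).** In degree `2n` the
member at block `i` has a class of type `(n,n)` iff block `i` is CENTRED (as many slots above as
below); for a partition into blocks of which exactly one contains the middle slot this singles out
ONE member per archimedean packet — the discrete series `A(n,n)` iff that block has size `1`. -/
theorem nn_mem_ajTypes_iff {r : ℕ} (b : Fin r → ℕ) (i : Fin r) (n : ℕ)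
    (hN : ∑ k, b k = 2 * n + 1) :
    (n, n) ∈ ajTypes b i ↔
      (∑ k ∈ Finset.univ.filter (· < i), b k) = ∑ k ∈ Finset.univ.filter (i < ·), b k ∧
        2 * (∑ k ∈ Finset.univ.filter (· < i), b k) + b i = 2 * n + 1 := by
  classical
  set Rp := ∑ k ∈ Finset.univ.filter (· < i), b k with hRp
  set Rm := ∑ k ∈ Finset.univ.filter (i < ·), b k with hRm
  -- the slots split as (above block i) + (block i) + (below block i)
  have hsplit : ∑ k, b k = Rp + (b i + Rm) := by
    rw [← Finset.sum_filter_add_sum_filter_not Finset.univ (· < i)]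
    congr 1
    have hset : Finset.univ.filter (fun k : Fin r ↦ ¬ k < i) =
        insert i (Finset.univ.filter (i < ·)) := by
      ext k
      simp only [Finset.mem_filter, Finset.mem_univ, true_and, Finset.mem_insert, not_lt]
      constructor
      · intro h
        rcases eq_or_lt_of_le h with h | h
        · exact Or.inl h.symm
        · exact Or.inr h
      · rintro (rfl | h)
        · exact le_rfl
        · exact le_of_lt h
    rw [hset, Finset.sum_insert (by simp)]
  rw [hN] at hsplit
  constructor
  · intro h
    obtain ⟨j, hj, hjn⟩ := Finset.mem_image.mp h
    simp only [Prod.mk.injEq] at hjn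
    obtain ⟨h1, h2⟩ := hjn
    refine ⟨by omega, by omega⟩
  · rintro ⟨h1, h2⟩
    refine Finset.mem_image.mpr ⟨n - Rp, Finset.mem_range.mpr (by omega), ?_⟩
    simp only [Prod.mk.injEq]
    exact ⟨by omega, by omega⟩

/-- **Census instance `N = 7` (`p = 6`, `m = 2`).** Blocks `(3,1,3)` = archimedean parameter
`μ⊠R₃ ⊕ χ₀ ⊕ μ'⊠R₃`: the central member is the discrete series `A(3,3)` (only type `(3,3)`), while
the member with non-compact block `{3,2,1}` has types `{(0,4),(1,5),(2,6)}` — it contributes the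
IMPURE type `(1,5)` to `H⁶`. Whether it shares `π_f` with `A(3,3)` is decided by the character of
the involution `s_{χ₀}` (card 2). -/
example : ajTypes ![3, 1, 3] 1 = {(3, 3)} ∧ ajTypes ![3, 1, 3] 0 = {(0, 4), (1, 5), (2, 6)} := by
  decide

/-- **Census instance `N = 5` (`p = 4`, `m = 1`), blocks `(2,1,2)` = `ρ⊠R₂ ⊕ χ₀`:** the non-DS
members have types `{(0,3),(1,4)}` and `{(3,0),(4,1)}` — odd degrees only, so `H⁴[π_f]` is pure
`(2,2)` (this reproduces finding F12(1) of the MiddleThetaSpan Disproof). -/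
example : ajTypes ![2, 1, 2] 0 = {(0, 3), (1, 4)} ∧ ajTypes ![2, 1, 2] 1 = {(2, 2)} ∧
    ajTypes ![2, 1, 2] 2 = {(3, 0), (4, 1)} := by
  decide

end Summit.HodgeConjecture.HodgeConjecture.Cruxes.OrthogonalEnveloped.IdeatorOne

end
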